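import Literature.Probability.LatticeModels.SixVertexSpectralRepresentation
import Literature.Probability.LatticeModels.SixVertexTransferMatrixPerron

/-!
# Six-vertex model on the cylinder: linearity of cylinder expectations and clustering of pair
# correlations at large horizontal separation (DKLM 2026, Part III, eq. (cylop) with Lemma 57;
# the "mixing" step in the proof of Theorem 23, Step 2)

H. Duminil-Copin, K. K. Kozlowski, P. Lammers, I. Manolescu, *Gaussian free field convergence of
the six-vertex model with `-1 ≤ Δ ≤ -1/2`*, arXiv:2603.06268 (2026) [DKLM2026SixVertexGFF]
(`paper:arxiv-2603.06268`, chunks p0041, p0044):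

> (eq. (cylop)) `𝔼_{CYL_L}[X] = lim_{M→∞} Trace(𝔬_X t^{M-(i'-i)}) / Trace t^M = v_0† 𝔒_X v_0.`
> Indeed, the rightmost equality is obtained by observing that only the largest eigenvalue of
> `t(π/2)` contributes. […] (proof of Theorem 23, Step 2) But this expectation may be written as
> `v_0† 𝔒_2 T(π/2)^n 𝔒_1 v_0`, where each `𝔒_i` measures one of the two height differences. As
> `n` tends to infinity, this tends to `v_0† 𝔒_2 v_0 v_0† 𝔒_1 v_0`, since `Λ_0(π/2) = 1` and all
> other eigenvalues have a modulus strictly smaller than `1`.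

For `a = b = 1`, `c > 0` and even circumference `L = 2(ℓ+1)`:

1. **Linearity** of the torus and cylinder expectations of strip observables in the observable
   (`torusCondExp_add/_smul`, `torusObsExp_add/_smul`, `cylinderObsExp_add/_smul`) and bilinearity
   of the pair expectations (`torusPairExp_add_left/_right`, `cylinderPairExp_add_left/_right`,
   `cylinderPairExp_smul_left/_right`) — the additivity used in Theorem 23, Steps 1–2.
2. **eq. (cylop) with a simple top eigenvalue** (Lemma 57): `cylinderObsExp_eq_top`,
   `𝔼_{CYL_L}[X] = (Uᵀ 𝔬_X U)_{i₀i₀} / Λ^{r'+1}` for the unique top index `i₀`.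
3. **Clustering**: `tendsto_cylinderPairExp_atTop`,
   `𝔼_{CYL_L}[X · τ_{(r₁'+1+k,0)} Y] → 𝔼_{CYL_L}[X] 𝔼_{CYL_L}[Y]` as `k → ∞`.

## References

* H. Duminil-Copin, K. K. Kozlowski, P. Lammers, I. Manolescu, arXiv:2603.06268 (2026), Part III
  §1 eq. (cylop), Lemma 57, and §3, proof of Theorem 23, Step 2. [DKLM2026SixVertexGFF]
-/

noncomputable section

open Finset Matrix Filter Topology
open Literature.LinearAlgebra.Matrix

namespace Literature.Probability.LatticeModels.SixVertex

/-! ## 1. Linearity -/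

section Linear

variable {G₁ G₂ : Type*} [AddGroup G₁] [AddGroup G₂] [One G₁] [One G₂] [Fintype G₁] [Fintype G₂]
  [DecidableEq G₁] [DecidableEq G₂]

/-- `𝔼_{𝕋}[F + G | balanced] = 𝔼_{𝕋}[F | balanced] + 𝔼_{𝕋}[G | balanced]`. [folklore] -/
theorem torusCondExp_add (a b c : ℝ) (F G : Config (G₁ × G₂) → ℝ) :
    torusCondExp a b c (F + G) = torusCondExp a b c F + torusCondExp a b c G := by
  unfold torusCondExp
  rw [← add_div, ← Finset.sum_add_distrib]
  congr 1
  refine Finset.sum_congr rfl fun ω _ => ?_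
  split_ifs
  · rw [Pi.add_apply, add_mul]
  · rw [add_zero]

/-- `𝔼_{𝕋}[r F | balanced] = r 𝔼_{𝕋}[F | balanced]`. [folklore] -/
theorem torusCondExp_smul (a b c r : ℝ) (F : Config (G₁ × G₂) → ℝ) :
    torusCondExp a b c (r • F) = r * torusCondExp a b c F := by
  unfold torusCondExp
  rw [mul_div_assoc', Finset.mul_sum]
  congr 1
  refine Finset.sum_congr rfl fun ω _ => ?_
  split_ifs
  · rw [Pi.smul_apply, smul_eq_mul, mul_assoc]
  · rw [mul_zero]

end Linear

section LinearObs

variable {G₂ : Type*} [AddGroup G₂] [One G₂] [Fintype G₂] [DecidableEq G₂]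

omit [AddGroup G₂] [One G₂] [Fintype G₂] [DecidableEq G₂] in
/-- Reading a sum of strip observables. [folklore] -/
theorem torusObs_add {M : ℕ} {r' : ℕ}
    (X Y : (G₂ → Bool) → (Fin (r' + 1) → G₂ → Bool) → (Fin (r' + 1) → G₂ → Bool) → ℝ) :
    torusObs (M := M) r' (X + Y) = torusObs r' X + torusObs r' Y := rfl

omit [AddGroup G₂] [One G₂] [Fintype G₂] [DecidableEq G₂] in
/-- Reading a multiple of a strip observable. [folklore] -/
theorem torusObs_smul {M : ℕ} {r' : ℕ} (r : ℝ)
    (X : (G₂ → Bool) → (Fin (r' + 1) → G₂ → Bool) → (Fin (r' + 1) → G₂ → Bool) → ℝ) :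
    torusObs (M := M) r' (r • X) = r • torusObs r' X := rfl

/-- Linearity of `𝔼_{𝕋_{M,L}}[· | balanced]` on strip observables: sums. [folklore] -/
theorem torusObsExp_add (c : ℝ) (M r' : ℕ)
    (X Y : (G₂ → Bool) → (Fin (r' + 1) → G₂ → Bool) → (Fin (r' + 1) → G₂ → Bool) → ℝ) :
    torusObsExp c M r' (X + Y) = torusObsExp c M r' X + torusObsExp c M r' Y := by
  unfold torusObsExp
  split_ifs with hM
  · rw [add_zero]
  · haveI : NeZero M := ⟨hM⟩
    rw [torusObs_add, torusCondExp_add]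

/-- Linearity of `𝔼_{𝕋_{M,L}}[· | balanced]` on strip observables: scalars. [folklore] -/
theorem torusObsExp_smul (c : ℝ) (M r' : ℕ) (r : ℝ)
    (X : (G₂ → Bool) → (Fin (r' + 1) → G₂ → Bool) → (Fin (r' + 1) → G₂ → Bool) → ℝ) :
    torusObsExp c M r' (r • X) = r * torusObsExp c M r' X := by
  unfold torusObsExp
  split_ifs with hM
  · rw [mul_zero]
  · haveI : NeZero M := ⟨hM⟩
    rw [torusObs_smul, torusCondExp_smul]

/-- **Additivity of `𝔼_{CYL_L}`** (`c > 0`). [cite: DKLM2026SixVertexGFF, proof of Theorem 23, Step 1 ("the additivity property")] -/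
theorem cylinderObsExp_add (c : ℝ) (hc : 0 < c) (r' : ℕ)
    (X Y : (G₂ → Bool) → (Fin (r' + 1) → G₂ → Bool) → (Fin (r' + 1) → G₂ → Bool) → ℝ) :
    cylinderObsExp c r' (X + Y) = cylinderObsExp c r' X + cylinderObsExp c r' Y := by
  have h := (tendsto_cylinderObsExp c hc r' X).add (tendsto_cylinderObsExp c hc r' Y)
  have h2 : Tendsto (fun M : ℕ => torusObsExp c M r' (X + Y)) atTop
      (𝓝 (cylinderObsExp c r' X + cylinderObsExp c r' Y)) :=
    h.congr fun M => (torusObsExp_add c M r' X Y).symm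
  exact tendsto_nhds_unique (tendsto_cylinderObsExp c hc r' (X + Y)) h2

/-- **Homogeneity of `𝔼_{CYL_L}`** (`c > 0`). [folklore] -/
theorem cylinderObsExp_smul (c : ℝ) (hc : 0 < c) (r' : ℕ) (r : ℝ)
    (X : (G₂ → Bool) → (Fin (r' + 1) → G₂ → Bool) → (Fin (r' + 1) → G₂ → Bool) → ℝ) :
    cylinderObsExp c r' (r • X) = r * cylinderObsExp c r' X := by
  have h := (tendsto_cylinderObsExp c hc r' X).const_mul r
  have h2 : Tendsto (fun M : ℕ => torusObsExp c M r' (r • X)) atTop (𝓝 (r * cylinderObsExp c r' X)) :=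
    h.congr fun M => (torusObsExp_smul c M r' r X).symm
  exact tendsto_nhds_unique (tendsto_cylinderObsExp c hc r' (r • X)) h2

omit [One G₂] [Fintype G₂] [DecidableEq G₂] in
/-- Bilinearity of the pair reading: left sums. [folklore] -/
theorem torusPairObs_add_left {M : ℕ} {r₁' r₂' : ℕ}
    (X X' : (G₂ → Bool) → (Fin (r₁' + 1) → G₂ → Bool) → (Fin (r₁' + 1) → G₂ → Bool) → ℝ) (n : ℕ)
    (Y : (G₂ → Bool) → (Fin (r₂' + 1) → G₂ → Bool) → (Fin (r₂' + 1) → G₂ → Bool) → ℝ) :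
    torusPairObs (M := M) r₁' (X + X') n r₂' Y = torusPairObs r₁' X n r₂' Y + torusPairObs r₁' X' n r₂' Y := by
  funext ω
  simp only [torusPairObs, torusObs_add, Pi.add_apply, add_mul]

omit [One G₂] [Fintype G₂] [DecidableEq G₂] in
/-- Bilinearity of the pair reading: right sums. [folklore] -/
theorem torusPairObs_add_right {M : ℕ} {r₁' r₂' : ℕ}
    (X : (G₂ → Bool) → (Fin (r₁' + 1) → G₂ → Bool) → (Fin (r₁' + 1) → G₂ → Bool) → ℝ) (n : ℕ)
    (Y Y' : (G₂ → Bool) → (Fin (r₂' + 1) → G₂ → Bool) → (Fin (r₂' + 1) → G₂ → Bool) → ℝ) :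
    torusPairObs (M := M) r₁' X n r₂' (Y + Y') = torusPairObs r₁' X n r₂' Y + torusPairObs r₁' X n r₂' Y' := by
  funext ω
  simp only [torusPairObs, torusObs_add, Pi.add_apply, mul_add]

omit [One G₂] [Fintype G₂] [DecidableEq G₂] in
/-- Bilinearity of the pair reading: left scalars. [folklore] -/
theorem torusPairObs_smul_left {M : ℕ} {r₁' r₂' : ℕ} (r : ℝ)
    (X : (G₂ → Bool) → (Fin (r₁' + 1) → G₂ → Bool) → (Fin (r₁' + 1) → G₂ → Bool) → ℝ) (n : ℕ)
    (Y : (G₂ → Bool) → (Fin (r₂' + 1) → G₂ → Bool) → (Fin (r₂' + 1) → G₂ → Bool) → ℝ) :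
    torusPairObs (M := M) r₁' (r • X) n r₂' Y = r • torusPairObs r₁' X n r₂' Y := by
  funext ω
  simp only [torusPairObs, torusObs_smul, Pi.smul_apply, smul_eq_mul, mul_assoc]

omit [One G₂] [Fintype G₂] [DecidableEq G₂] in
/-- Bilinearity of the pair reading: right scalars. [folklore] -/
theorem torusPairObs_smul_right {M : ℕ} {r₁' r₂' : ℕ} (r : ℝ)
    (X : (G₂ → Bool) → (Fin (r₁' + 1) → G₂ → Bool) → (Fin (r₁' + 1) → G₂ → Bool) → ℝ) (n : ℕ)
    (Y : (G₂ → Bool) → (Fin (r₂' + 1) → G₂ → Bool) → (Fin (r₂' + 1) → G₂ → Bool) → ℝ) :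
    torusPairObs (M := M) r₁' X n r₂' (r • Y) = r • torusPairObs r₁' X n r₂' Y := by
  funext ω
  simp only [torusPairObs, torusObs_smul, Pi.smul_apply, smul_eq_mul]
  ring

/-- Bilinearity of `𝔼_{𝕋_{M,L}}[X · τ Y | balanced]`: left sums. [folklore] -/
theorem torusPairExp_add_left (c : ℝ) (M : ℕ) {r₁' r₂' : ℕ}
    (X X' : (G₂ → Bool) → (Fin (r₁' + 1) → G₂ → Bool) → (Fin (r₁' + 1) → G₂ → Bool) → ℝ) (n : ℕ)
    (Y : (G₂ → Bool) → (Fin (r₂' + 1) → G₂ → Bool) → (Fin (r₂' + 1) → G₂ → Bool) → ℝ) :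
    torusPairExp c M r₁' (X + X') n r₂' Y = torusPairExp c M r₁' X n r₂' Y + torusPairExp c M r₁' X' n r₂' Y := by
  unfold torusPairExp
  split_ifs with hM
  · rw [add_zero]
  · haveI : NeZero M := ⟨hM⟩
    rw [torusPairObs_add_left, torusCondExp_add]

/-- Bilinearity of `𝔼_{𝕋_{M,L}}[X · τ Y | balanced]`: right sums. [folklore] -/
theorem torusPairExp_add_right (c : ℝ) (M : ℕ) {r₁' r₂' : ℕ}
    (X : (G₂ → Bool) → (Fin (r₁' + 1) → G₂ → Bool) → (Fin (r₁' + 1) → G₂ → Bool) → ℝ) (n : ℕ)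
    (Y Y' : (G₂ → Bool) → (Fin (r₂' + 1) → G₂ → Bool) → (Fin (r₂' + 1) → G₂ → Bool) → ℝ) :
    torusPairExp c M r₁' X n r₂' (Y + Y') = torusPairExp c M r₁' X n r₂' Y + torusPairExp c M r₁' X n r₂' Y' := by
  unfold torusPairExp
  split_ifs with hM
  · rw [add_zero]
  · haveI : NeZero M := ⟨hM⟩
    rw [torusPairObs_add_right, torusCondExp_add]

/-- Bilinearity: left scalars. [folklore] -/
theorem torusPairExp_smul_left (c : ℝ) (M : ℕ) {r₁' r₂' : ℕ} (r : ℝ)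
    (X : (G₂ → Bool) → (Fin (r₁' + 1) → G₂ → Bool) → (Fin (r₁' + 1) → G₂ → Bool) → ℝ) (n : ℕ)
    (Y : (G₂ → Bool) → (Fin (r₂' + 1) → G₂ → Bool) → (Fin (r₂' + 1) → G₂ → Bool) → ℝ) :
    torusPairExp c M r₁' (r • X) n r₂' Y = r * torusPairExp c M r₁' X n r₂' Y := by
  unfold torusPairExp
  split_ifs with hM
  · rw [mul_zero]
  · haveI : NeZero M := ⟨hM⟩
    rw [torusPairObs_smul_left, torusCondExp_smul]

/-- Bilinearity: right scalars. [folklore] -/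
theorem torusPairExp_smul_right (c : ℝ) (M : ℕ) {r₁' r₂' : ℕ} (r : ℝ)
    (X : (G₂ → Bool) → (Fin (r₁' + 1) → G₂ → Bool) → (Fin (r₁' + 1) → G₂ → Bool) → ℝ) (n : ℕ)
    (Y : (G₂ → Bool) → (Fin (r₂' + 1) → G₂ → Bool) → (Fin (r₂' + 1) → G₂ → Bool) → ℝ) :
    torusPairExp c M r₁' X n r₂' (r • Y) = r * torusPairExp c M r₁' X n r₂' Y := by
  unfold torusPairExp
  split_ifs with hM
  · rw [mul_zero]
  · haveI : NeZero M := ⟨hM⟩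
    rw [torusPairObs_smul_right, torusCondExp_smul]

variable [Nonempty {κ : G₂ → Bool // IsBalancedCol κ}]

/-- The pair expectations converge to the cylinder pair expectation (gap `k ≥ 0`).
[cite: DKLM2026SixVertexGFF, Theorem 26 (i)] -/
theorem tendsto_torusPairExp_cylinderPairExp (c : ℝ) (hc : 0 < c) {r₁' r₂' : ℕ}
    (X : (G₂ → Bool) → (Fin (r₁' + 1) → G₂ → Bool) → (Fin (r₁' + 1) → G₂ → Bool) → ℝ)
    (Y : (G₂ → Bool) → (Fin (r₂' + 1) → G₂ → Bool) → (Fin (r₂' + 1) → G₂ → Bool) → ℝ) (k : ℕ) :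
    Tendsto (fun M : ℕ => torusPairExp c M r₁' X (r₁' + 1 + k) r₂' Y) atTop
      (𝓝 (cylinderPairExp c r₁' X (r₁' + 1 + k) r₂' Y)) := by
  rw [cylinderPairExp_eq_sum c hc X Y k]
  exact tendsto_torusPairExp c hc X Y k

/-- **Bilinearity of `𝔼_{CYL_L}[X · τ_k Y]`**: left sums.
[cite: DKLM2026SixVertexGFF, proof of Theorem 23, Step 1 ("the additivity property")] -/
theorem cylinderPairExp_add_left (c : ℝ) (hc : 0 < c) {r₁' r₂' : ℕ}
    (X X' : (G₂ → Bool) → (Fin (r₁' + 1) → G₂ → Bool) → (Fin (r₁' + 1) → G₂ → Bool) → ℝ)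
    (Y : (G₂ → Bool) → (Fin (r₂' + 1) → G₂ → Bool) → (Fin (r₂' + 1) → G₂ → Bool) → ℝ) (k : ℕ) :
    cylinderPairExp c r₁' (X + X') (r₁' + 1 + k) r₂' Y =
      cylinderPairExp c r₁' X (r₁' + 1 + k) r₂' Y + cylinderPairExp c r₁' X' (r₁' + 1 + k) r₂' Y := by
  have h := (tendsto_torusPairExp_cylinderPairExp c hc X Y k).add
    (tendsto_torusPairExp_cylinderPairExp c hc X' Y k)
  exact tendsto_nhds_unique (tendsto_torusPairExp_cylinderPairExp c hc (X + X') Y k)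
    (h.congr fun M => (torusPairExp_add_left c M X X' _ Y).symm)

/-- **Bilinearity of `𝔼_{CYL_L}[X · τ_k Y]`**: right sums. [cite: DKLM2026SixVertexGFF, proof of Theorem 23, Step 1] -/
theorem cylinderPairExp_add_right (c : ℝ) (hc : 0 < c) {r₁' r₂' : ℕ}
    (X : (G₂ → Bool) → (Fin (r₁' + 1) → G₂ → Bool) → (Fin (r₁' + 1) → G₂ → Bool) → ℝ)
    (Y Y' : (G₂ → Bool) → (Fin (r₂' + 1) → G₂ → Bool) → (Fin (r₂' + 1) → G₂ → Bool) → ℝ) (k : ℕ) :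
    cylinderPairExp c r₁' X (r₁' + 1 + k) r₂' (Y + Y') =
      cylinderPairExp c r₁' X (r₁' + 1 + k) r₂' Y + cylinderPairExp c r₁' X (r₁' + 1 + k) r₂' Y' := by
  have h := (tendsto_torusPairExp_cylinderPairExp c hc X Y k).add
    (tendsto_torusPairExp_cylinderPairExp c hc X Y' k)
  exact tendsto_nhds_unique (tendsto_torusPairExp_cylinderPairExp c hc X (Y + Y') k)
    (h.congr fun M => (torusPairExp_add_right c M X _ Y Y').symm)

/-- Bilinearity: left scalars. [folklore] -/
theorem cylinderPairExp_smul_left (c : ℝ) (hc : 0 < c) {r₁' r₂' : ℕ} (r : ℝ)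
    (X : (G₂ → Bool) → (Fin (r₁' + 1) → G₂ → Bool) → (Fin (r₁' + 1) → G₂ → Bool) → ℝ)
    (Y : (G₂ → Bool) → (Fin (r₂' + 1) → G₂ → Bool) → (Fin (r₂' + 1) → G₂ → Bool) → ℝ) (k : ℕ) :
    cylinderPairExp c r₁' (r • X) (r₁' + 1 + k) r₂' Y = r * cylinderPairExp c r₁' X (r₁' + 1 + k) r₂' Y := by
  have h := (tendsto_torusPairExp_cylinderPairExp c hc X Y k).const_mul r
  exact tendsto_nhds_unique (tendsto_torusPairExp_cylinderPairExp c hc (r • X) Y k)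
    (h.congr fun M => (torusPairExp_smul_left c M r X _ Y).symm)

/-- Bilinearity: right scalars. [folklore] -/
theorem cylinderPairExp_smul_right (c : ℝ) (hc : 0 < c) {r₁' r₂' : ℕ} (r : ℝ)
    (X : (G₂ → Bool) → (Fin (r₁' + 1) → G₂ → Bool) → (Fin (r₁' + 1) → G₂ → Bool) → ℝ)
    (Y : (G₂ → Bool) → (Fin (r₂' + 1) → G₂ → Bool) → (Fin (r₂' + 1) → G₂ → Bool) → ℝ) (k : ℕ) :
    cylinderPairExp c r₁' X (r₁' + 1 + k) r₂' (r • Y) = r * cylinderPairExp c r₁' X (r₁' + 1 + k) r₂' Y := by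
  have h := (tendsto_torusPairExp_cylinderPairExp c hc X Y k).const_mul r
  exact tendsto_nhds_unique (tendsto_torusPairExp_cylinderPairExp c hc X (r • Y) k)
    (h.congr fun M => (torusPairExp_smul_right c M r X _ Y).symm)

end LinearObs

/-! ## 2. eq. (cylop) and clustering with a simple top eigenvalue (`L = 2(ℓ+1)`) -/

section Cluster

variable (c : ℝ) (hc : 0 < c) (ℓ : ℕ)

include hc

/-- The unique top index of the real eigenbasis `eigU` (Lemma 57: `d = 1`). [cite: DKLM2026SixVertexGFF, Lemma 57] -/
theorem exists_unique_top :
    ∃ i₀, (Finset.univ.filter fun i =>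
        (balancedTransferMatrix_isHermitian (G₂ := ZMod (2 * (ℓ + 1))) 1 c).eigenvalues i =
          topEigenvalue (balancedTransferMatrix_isHermitian (G₂ := ZMod (2 * (ℓ + 1))) 1 c)) = {i₀} :=
  Finset.card_eq_one.mp (card_filter_eigenvalues_balancedTransferMatrix_eq_one hc ℓ)

/-- **The top index `i₀`** of the real eigenbasis of `t(π/2)`. [cite: DKLM2026SixVertexGFF, Lemma 57] -/
def realTopIdx : {κ : ZMod (2 * (ℓ + 1)) → Bool // IsBalancedCol κ} :=
  Classical.choose (exists_unique_top c hc ℓ)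

/-- The top filter is the singleton `{i₀}`. [cite: DKLM2026SixVertexGFF, Lemma 57] -/
theorem filter_top_eq_singleton :
    (Finset.univ.filter fun i =>
        (balancedTransferMatrix_isHermitian (G₂ := ZMod (2 * (ℓ + 1))) 1 c).eigenvalues i =
          topEigenvalue (balancedTransferMatrix_isHermitian (G₂ := ZMod (2 * (ℓ + 1))) 1 c)) =
      {realTopIdx c hc ℓ} :=
  Classical.choose_spec (exists_unique_top c hc ℓ)

/-- `λ_{i₀} = Λ`. [cite: DKLM2026SixVertexGFF, Lemma 57] -/
theorem eigenvalues_realTopIdx :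
    (balancedTransferMatrix_isHermitian (G₂ := ZMod (2 * (ℓ + 1))) 1 c).eigenvalues (realTopIdx c hc ℓ) =
      topEigenvalue (balancedTransferMatrix_isHermitian (G₂ := ZMod (2 * (ℓ + 1))) 1 c) := by
  have h : realTopIdx c hc ℓ ∈ (Finset.univ.filter fun i =>
      (balancedTransferMatrix_isHermitian (G₂ := ZMod (2 * (ℓ + 1))) 1 c).eigenvalues i =
        topEigenvalue (balancedTransferMatrix_isHermitian (G₂ := ZMod (2 * (ℓ + 1))) 1 c)) := by
    rw [filter_top_eq_singleton c hc ℓ]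
    exact Finset.mem_singleton_self _
  simpa using h

/-- `λ_i = Λ ↔ i = i₀`. [cite: DKLM2026SixVertexGFF, Lemma 57] -/
theorem eigenvalues_eq_top_iff (i : {κ : ZMod (2 * (ℓ + 1)) → Bool // IsBalancedCol κ}) :
    (balancedTransferMatrix_isHermitian (G₂ := ZMod (2 * (ℓ + 1))) 1 c).eigenvalues i =
        topEigenvalue (balancedTransferMatrix_isHermitian (G₂ := ZMod (2 * (ℓ + 1))) 1 c) ↔
      i = realTopIdx c hc ℓ := by
  have h := filter_top_eq_singleton c hc ℓ
  constructor
  · intro hi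
    have hmem : i ∈ (Finset.univ.filter fun i =>
        (balancedTransferMatrix_isHermitian (G₂ := ZMod (2 * (ℓ + 1))) 1 c).eigenvalues i =
          topEigenvalue (balancedTransferMatrix_isHermitian (G₂ := ZMod (2 * (ℓ + 1))) 1 c)) := by
      simp [hi]
    rw [h] at hmem
    exact Finset.mem_singleton.mp hmem
  · intro hi
    rw [hi]
    exact eigenvalues_realTopIdx c hc ℓ

/-- **eq. (cylop) with a simple top eigenvalue**: `𝔼_{CYL_L}[X] = (Uᵀ 𝔬_X U)_{i₀i₀} / Λ^{r'+1}`
(`= v_0† 𝔒_X v_0`). [cite: DKLM2026SixVertexGFF, Part III §1, eq. (cylop)] -/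
theorem cylinderObsExp_eq_top (r' : ℕ)
    (X : (ZMod (2 * (ℓ + 1)) → Bool) → (Fin (r' + 1) → ZMod (2 * (ℓ + 1)) → Bool) →
      (Fin (r' + 1) → ZMod (2 * (ℓ + 1)) → Bool) → ℝ) :
    cylinderObsExp c r' X =
      (star (eigU (balancedTransferMatrix_isHermitian (G₂ := ZMod (2 * (ℓ + 1))) 1 c)) *
          balObsMatrix 1 1 c r' X *
          eigU (balancedTransferMatrix_isHermitian (G₂ := ZMod (2 * (ℓ + 1))) 1 c))
        (realTopIdx c hc ℓ) (realTopIdx c hc ℓ) /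
      topEigenvalue (balancedTransferMatrix_isHermitian (G₂ := ZMod (2 * (ℓ + 1))) 1 c) ^ (r' + 1) := by
  rw [cylinderObsExp_eq c hc r' X, filter_top_eq_singleton c hc ℓ, Finset.sum_singleton,
    Finset.card_singleton, Nat.cast_one, one_mul]

/-- The spectral weight at the top index factorises: `c_{i₀}(X, Y) = 𝔼_{CYL_L}[X] 𝔼_{CYL_L}[Y]`.
[cite: DKLM2026SixVertexGFF, proof of Theorem 23, Step 2] -/
theorem spectralWeight_realTopIdx {r₁' r₂' : ℕ}
    (X : (ZMod (2 * (ℓ + 1)) → Bool) → (Fin (r₁' + 1) → ZMod (2 * (ℓ + 1)) → Bool) →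
      (Fin (r₁' + 1) → ZMod (2 * (ℓ + 1)) → Bool) → ℝ)
    (Y : (ZMod (2 * (ℓ + 1)) → Bool) → (Fin (r₂' + 1) → ZMod (2 * (ℓ + 1)) → Bool) →
      (Fin (r₂' + 1) → ZMod (2 * (ℓ + 1)) → Bool) → ℝ) :
    spectralWeight c X Y (realTopIdx c hc ℓ) = cylinderObsExp c r₁' X * cylinderObsExp c r₂' Y := by
  unfold spectralWeight pairSpectralWeight
  rw [filter_top_eq_singleton c hc ℓ, Finset.sum_singleton, Finset.card_singleton, Nat.cast_one, one_mul,
    cylinderObsExp_eq_top c hc ℓ r₁' X, cylinderObsExp_eq_top c hc ℓ r₂' Y, pow_add, div_mul_div_comm]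

/-- **Clustering of cylinder pair correlations**: as the horizontal gap `k → ∞`,
`𝔼_{CYL_L}[X · τ_{(r₁'+1+k,0)} Y] → 𝔼_{CYL_L}[X] 𝔼_{CYL_L}[Y]` ("since `Λ_0(π/2) = 1` and all
other eigenvalues have a modulus strictly smaller than `1`").
[cite: DKLM2026SixVertexGFF, proof of Theorem 23, Step 2] -/
theorem tendsto_cylinderPairExp_atTop {r₁' r₂' : ℕ}
    (X : (ZMod (2 * (ℓ + 1)) → Bool) → (Fin (r₁' + 1) → ZMod (2 * (ℓ + 1)) → Bool) →
      (Fin (r₁' + 1) → ZMod (2 * (ℓ + 1)) → Bool) → ℝ)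
    (Y : (ZMod (2 * (ℓ + 1)) → Bool) → (Fin (r₂' + 1) → ZMod (2 * (ℓ + 1)) → Bool) →
      (Fin (r₂' + 1) → ZMod (2 * (ℓ + 1)) → Bool) → ℝ) :
    Tendsto (fun k : ℕ => cylinderPairExp c r₁' X (r₁' + 1 + k) r₂' Y) atTop
      (𝓝 (cylinderObsExp c r₁' X * cylinderObsExp c r₂' Y)) := by
  set hA := balancedTransferMatrix_isHermitian (G₂ := ZMod (2 * (ℓ + 1))) 1 c
  obtain ⟨δ, hδ, hdiag⟩ := exists_balancedTransferMatrix_diag_ge (G₂ := ZMod (2 * (ℓ + 1))) c hc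
  have hΛ : 0 < topEigenvalue hA := topEigenvalue_pos_of_diag hA hδ hdiag
  -- `(1 - a_j)^k → 𝟙{j = i₀}`
  have hlim : ∀ j, Tendsto (fun k : ℕ => (1 - spectralAtom c j) ^ k) atTop
      (𝓝 (if j = realTopIdx c hc ℓ then 1 else 0)) := by
    intro j
    unfold spectralAtom
    rw [sub_sub_cancel]
    by_cases h : j = realTopIdx c hc ℓ
    · rw [if_pos h, (eigenvalues_eq_top_iff c hc ℓ j).2 h, div_self hΛ.ne']
      simp
    · rw [if_neg h]
      refine tendsto_pow_atTop_nhds_zero_of_abs_lt_one ?_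
      exact abs_div_topEigenvalue_lt_one hA (balancedTransferMatrix_offdiag_nonneg c hc) hδ hdiag
        (fun he => h ((eigenvalues_eq_top_iff c hc ℓ j).1 he))
  have hsum : Tendsto (fun k : ℕ => ∑ j, spectralWeight c X Y j * (1 - spectralAtom c j) ^ k) atTop
      (𝓝 (∑ j, spectralWeight c X Y j * if j = realTopIdx c hc ℓ then 1 else 0)) :=
    tendsto_finsetSum _ fun j _ => (hlim j).const_mul _
  rw [show (∑ j, spectralWeight c X Y j * if j = realTopIdx c hc ℓ then (1 : ℝ) else 0) =
      cylinderObsExp c r₁' X * cylinderObsExp c r₂' Y by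
    simp [Finset.sum_ite_eq', spectralWeight_realTopIdx c hc ℓ X Y]] at hsum
  exact hsum.congr fun k => (cylinderPairExp_eq_sum c hc X Y k).symm

end Cluster

end Literature.Probability.LatticeModels.SixVertex

end
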